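import Summits.QuantumFields.YangMills.Theorems.BalabanUVNodesN22AtRecordOfDichotomyLetter
import Summits.QuantumFields.YangMills.Theorems.BalabanUVNodesN22WindowedNE9DichotomyEHolo
import Summits.QuantumFields.YangMills.Theorems.BalabanUVNodesN22WindowedNE9OfStripSchemas

/-!
# NODE N22 (NE9) — K3⁷ v5 §2b's `h9` and the N22 pin face AT THE RECORD FROM THE PER-STEP SCHEMAS: node N09's `EHoloAt` FAMILIES at node00-def-W1's towers of record
# for the last coupling (J33 part 3), and the STRIP lineage's all-coupling output-level holomorphy (J35) — «J33-3-at-record» ∕ «J35-at-record»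

Cell `pub-ymgap`, Track A (HUMAN RULING D-0062), WIDTH SEAT `dag-n22-w5` (g0′, harness re-seat of base w5) on node n22 = NE9, D-0154 (3a) second width wave;
`--kind proof --supports stmt-QuantumFields-20544 --as helper` (K3⁷ `SpineGivenEndpointR13SepCoPH`, skeleton v5 941dddb108cbaacf), COUNT-NEUTRAL; THEOREMS ONLY (0 `def`,
0 `sorry`, standard axioms).  The two «open one-liners» released by this seat's g0 (pub-ymgap INBOX 2026-08-28T08:16:55Z) — each ONE application of `…N22AtRecordOfDichotomyLetter`
§1 (this seat, p613896): `ne9_EA_objectsOfRecord₁₃_of_windowedLetter` ∕ `n22At_rateCarriers_of_kernels_pin_of_ne9` — to dag-n22-c g13's (β′) letters J33 part 3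
`windowedNE9_localizedSum_of_olderCoordHolo_eHoloAt` (p612302) and J35 `windowedNE9_localizedSum_of_stripSchemas` (p615191).  Nothing of J33∕J35∕J32′∕W1-19b∕p593053 is
re-declared; every step is plain application.

WHAT.
* §1 J33-3 AT THE RECORD: ★★★ `ne9_EA_objectsOfRecord₁₃_of_olderCoordHolo_eHoloAt_analyticH` ∕ ★★★ `n22At_rateCarriers_of_kernels_pin_of_olderCoordHolo_eHoloAt_analyticH` — towers
  `S K : ClusterTower (F.P K) 𝔸 M` (`M = L^{m′}`; `𝔸` a complete normed ℂ-algebra) read through `emb : ReadingMaps F (MatA N) 𝔸` with W1-20's law `Localizes17OfRecord₁₃ F N θ S emb`,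
  at the space tables of record `U^c_{k+1}(X, c.α₀, c.α₁)` of the tori's settings `(Sg K, Rz K)`; per `(K, k)`: PRINTED (2.38) `Bound238` on the box `W1.box θ.γ k`, the
  OLDER-coordinate activity margin datum `hO` (radii `ϱt (k+1) i`, `i < k`), PRINTED `AnalyticH` on the box; node N09's `EHoloAt (sfTowerOfRecord (Sg K) (Rz K) M (S K) ⟨g, β K⟩
  (logZ K)) c k` — ONE per torus, window history and step, uniform letters `H.E₀ ≤ E₀`, `r_E ≤ H.r` (`θ.γ ≤ c.γ`, `κ ≤ c.κ`); holomorphic complexified probe readings `Φ K k X` of the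
  record's β-chart with chart∕space clauses; site weights with the minimizer tails ([I] p. 282); Road 1's numerals; `PolLimitsExistOfRecord₁₃ F N θ`; a letter block `ℓ` with its
  signs DOMINATING J33-3's table `C·(if i + 1 < n then c₀·4A∕ϱt n i else 4E₀∕r_E)` ⟹ `NE9 ((objectsOfRecord₁₃ F N θ ℓ).EA 0) (Window θ.γ) ℓ.κ ℓ.moduli` (= K3⁷ v5 §2b's `h9`)
  and, under `hpin`, `N22At (rateCarriersOfRecord₁₃CoPH 𝔯 F θ hP g₀ os k).u3` for EVERY `k`.  J33-3's activity-holomorphy binder `hHhol` is DISCHARGED, as in p613896 §2, by J32′ §1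
  `differentiableOn_H_comp_of_analyticH` from PRINTED `AnalyticH` + holomorphic readings.
* §2 J35 AT THE RECORD: ★★★ `ne9_EA_objectsOfRecord₁₃_of_stripSchemas` ∕ ★★★ `n22At_rateCarriers_of_kernels_pin_of_stripSchemas` — the same conclusions from the STRIP lineage's
  inputs per torus: node N10's older-coupling level-T hypothesis `h226TOnOlder` UNIVERSAL IN THE DOMAIN ([II] (2.14)–(2.26) on a common complex domain of one older coupling),
  node N09's `EHoloAt` families with uniform letters `(E₀, r_E > 0)`, the Lemma-3 socket numerals `Lemma3Numerics c M (½L) …`, `8 ≤ c.L`, S25's clauses at `A := C₃ε₁`, the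
  renewal `e·9·64·K₀(64,8)²·C₃ε₁ ≤ E₀`, `θ.γ ≤ cs.γ`, `κ ≤ cs.κ`; J34's term holomorphy through the complexified readings (chart∕space clauses at `X`), tails, `δ₀ > 0`,
  `2κ₀(64,8) ≤ κ_w ≤ κ`; `PolLimitsExistOfRecord₁₃ F N θ`; a letter block dominating the constant table `C·4E₀∕r_E`, `C = (16B₃²∕r²)e^{12Mδ₁}K₀(64,8)K₁(4,δ₀∕2)`.
  THE N22 ROW SENTENCE AT (β), SCHEMA CURRENCY: «W1-20's law + N10's older-coupling schema + N09's `EHoloAt` families + term holomorphy through the readings + p. 282 tails +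
  (1.21) existence + numerals + a dominating letter block ⇒ v5 §2b `h9` ∕ `N22At` at the pinned bundle, every run length».

HONEST FRAMING (binding).  Count-neutral COMPOSITION of landed theorems by name; NO estimate of Bałaban's is proved or asserted; every displayed input is a HYPOTHESIS with its
owner (printed (2.38) ∕ `h226TOnOlder`: N10 — the common complex domain is the cell's complexification «(or analytic)», NOT a printed display; older activity margins: N10's
T-row complexified ∕ NODE A; `EHoloAt` families at `sfTowerOfRecord`: node N09 — their existence at Bałaban's objects is N09's theorem, not claimed here; readings + term ∕
activity holomorphy through them + tails: NODE A ∕ N09; law: NODE A ∕ N10 ∕ def-W1; (1.21): dag-n22-w3's road); nothing of the record is constructed or claimed to meet them;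
N22 is NOT discharged (typed 28∕28 · discharged 5∕27 UNCHANGED); K3⁷ OPEN and NOT claimed; NE9 is NOT IN PRINT for d = 4; no count claim (the chair's single count line is the
only count); no summit statement is proved by this seat; one finite 𝕋⁴ programme at fixed ε — R4 closes the CONDITIONAL rung `BalabanLadder.UV` only; NOTHING about the
continuum limit, ℝ⁴, infinite volume, OS axioms, a mass gap or the Clay problem is proved or claimed by any of this.  References (TYPES only, no cite tags on the Summit side):
[I] = Bałaban, CMP 109 (1987) (1.7) p. 261, §1 p. 263, §2 p. 266, (1.18) p. 263, (1.20)–(1.21) p. 264, p. 282, (5.10) p. 293; [II] = CMP 116 (1988) (2.3) p. 12, (2.13)–(2.26)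
pp. 14–17, Lemma 3 (2.38) p. 20, (2.39)–(2.41) p. 21.
-/

noncomputable section

open Filter Topology Metric Set
open scoped BigOperators

namespace YMDAG.N22.AtRecordOfPrintedSlots

open Literature.MathematicalPhysics.QuantumFieldTheory.Balaban1983to89
open Literature.MathematicalPhysics.QuantumFieldTheory.Balaban1983to89.T4Continuum (T4Family ULoop)
open Literature.MathematicalPhysics.QuantumFieldTheory.Balaban1983to89.T4OutputRate (Window NE9)
open Literature.MathematicalPhysics.QuantumFieldTheory.Balaban1983to89.TreeLengthTorus (TPt TDom torusTreeLen)
open Literature.MathematicalPhysics.QuantumFieldTheory.Balaban1983to89.B12TreeDecay (K₀ kappa₀ K₀_pos)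
open Literature.MathematicalPhysics.QuantumFieldTheory.Balaban1983to89.B12Decay510 (delta1)
open Literature.MathematicalPhysics.QuantumFieldTheory.Balaban1983to89.B12Decay510Window (K₁)
open Literature.MathematicalPhysics.QuantumFieldTheory.Balaban1983to89.B12Decay510Torus (distCT nearT)
open Literature.MathematicalPhysics.QuantumFieldTheory.Balaban1983to89.B13Lemma3TorusData (TBond)
open Literature.MathematicalPhysics.QuantumFieldTheory.Balaban1983to89.B13Lemma3TorusTerms (terms weight)
open Literature.MathematicalPhysics.QuantumFieldTheory.Balaban1983to89.B13Lemma3TorusSocket (Lemma3Numerics)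
open Literature.MathematicalPhysics.QuantumFieldTheory.Balaban1983to89.B12BetaHolo (EHoloAt)
open Literature.MathematicalPhysics.QuantumFieldTheory.Balaban1983to89.Step (SFConsts)
open Literature.MathematicalPhysics.QuantumFieldTheory.Balaban1983to89.Node00
open Literature.MathematicalPhysics.QuantumFieldTheory.Balaban1983to89.Node00.Sect2 (domSys domCount CPair spaceI domSites Setting Residual)
open Literature.MathematicalPhysics.QuantumFieldTheory.Balaban1983to89.Node00.W1
open Literature.MathematicalPhysics.QuantumFieldTheory.Balaban1983to89.Node00.LocalizedSum17 (localizedSum ReadingMaps Localizes17OfRecord₁₃)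
open Literature.MathematicalPhysics.QuantumFieldTheory.Balaban1983to89.Node00.U3OfKernels (histPrefix objectsOfRecord₁₃)
open Literature.MathematicalPhysics.QuantumFieldTheory.Balaban1983to89.Node00.U3KernelLetters (WindowedNE9 PolLimitsExistOfRecord₁₃)
open YMDAG.UVSplit (N22At RateReading₁₃CoPH rateCarriersOfRecord₁₃CoPH)
open YMDAG.N22.AtKernels (n22At_rateCarriers_of_kernels_pin_of_ne9)
open YMDAG.N22.WindowedOfCouplingHolo (differentiableOn_H_comp_of_analyticH histPrefix_mem_box)
open YMDAG.N22.Dichotomy (windowedNE9_localizedSum_of_olderCoordHolo_eHoloAt)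
open YMDAG.N22.OutputLevel (windowedNE9_localizedSum_of_stripSchemas)

open scoped Matrix.Norms.L2Operator

variable (F : T4Family) (N : ℕ) [NeZero N]

/-! ## §1 J33 part 3 READ AT THE RECORD: printed (2.38) + older activity margins + node N09's `EHoloAt` families (activity holomorphy from PRINTED `AnalyticH`) -/

open Classical in
/-- ★★★ **K3⁷ v5 §2b's `h9` FROM PRINTED (2.38) + OLDER ACTIVITY MARGINS + NODE N09's `EHoloAt` FAMILIES** (J33 part 3 at the record).  Towers `S K : ClusterTower (F.P K) 𝔸 M`
(`M = L^{m′}`) read through `emb : ReadingMaps F (MatA N) 𝔸` with W1-20's law, at the space tables of record `U^c_{k+1}(X, c.α₀, c.α₁)` of the settings `(Sg K, Rz K)`; per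
`(K, k)`: `Bound238` on the box, the OLDER-coordinate margin datum `hO` (radii `ϱt (k+1) i`, `i < k`), PRINTED `AnalyticH` on the box; one `EHoloAt (sfTowerOfRecord (Sg K) (Rz K) M
(S K) ⟨g, β K⟩ (logZ K)) c k` per torus, window history and step with uniform letters `(E₀, r_E)`, `θ.γ ≤ c.γ`, `κ ≤ c.κ`; holomorphic readings with chart∕space clauses; site weights
with tails; Road 1's numerals; `PolLimitsExistOfRecord₁₃ F N θ`; a letter block dominating J33-3's table ⟹ `NE9 ((objectsOfRecord₁₃ F N θ ℓ).EA 0) (Window θ.γ) ℓ.κ ℓ.moduli` —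
J33-3 `windowedNE9_localizedSum_of_olderCoordHolo_eHoloAt` at `W := Window θ.γ` (its `hHhol` by J32′ §1 `differentiableOn_H_comp_of_analyticH`) ∘ p613896 §1
`ne9_EA_objectsOfRecord₁₃_of_windowedLetter`.  LOCATED (hypothesis form); N22 NOT discharged. -/
theorem ne9_EA_objectsOfRecord₁₃_of_olderCoordHolo_eHoloAt_analyticH (θ : Stage13Params F N) (ℓ : U3Letters₁₁) (hs : ℓ.Signs)
    (hlim : PolLimitsExistOfRecord₁₃ F N θ) {𝔸 : Type*} [NormedRing 𝔸] [NormedAlgebra ℂ 𝔸] [CompleteSpace 𝔸] {G : Type*} [GaugeGroup G]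
    (m' : ℕ) (M : ℕ) [NeZero M] (hM : M = F.L ^ m')
    (S : (K : ℕ) → ClusterTower (F.P K) 𝔸 M) (emb : ReadingMaps F (MatA N) 𝔸) (hloc : Localizes17OfRecord₁₃ F N θ S emb)
    (Sg : (K : ℕ) → Setting 𝔸 G) (Rz : (K : ℕ) → Residual (F.P K) 𝔸) (logZ : (K : ℕ) → ℕ → GaugeField (F.P K) 0 G → ℝ) (β : ℕ → ℕ → ℝ → ℝ)
    (c : SFConsts) (hγ : θ.γ ≤ c.γ)
    {A R r₁ κ δ₀ B₃ r E₀ rE : ℝ} (ϱt : ℕ → ℕ → ℝ) (hϱt : ∀ n i, 0 < ϱt n i)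
    (hA : 0 < A) (hr₁ : 0 ≤ r₁) (hκ : κ ≤ r₁) (hκ₀ : kappa₀ (4 * 2 ^ 4) (2 * 4) ≤ κ / 2) (hrate : r₁ + 2 * (64 * Real.log 162) + 2 ≤ R)
    (hsmall : 2 * A * Real.exp (5 * r₁ + 1) * K₀ 64 8 * 9 * 64 ≤ 1) (hδ₀ : 0 < δ₀) (hB₃ : 0 ≤ B₃) (hr : 0 < r)
    (hE₀ : 0 ≤ E₀) (hrE : 0 < rE) (hκc : κ ≤ c.κ)
    (h238 : ∀ K k, ((S K) k).Bound238 (box θ.γ k) (fun X => spaceI (Sg K) (Rz K) M (k + 1) (domSites (F.P K) M (k + 1) X) c.α₀ c.α₁) A R)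
    (hO : ∀ (K k : ℕ), ∀ g ∈ box θ.γ k, ∀ (Z : (domSys (F.P K) M (k + 1)).Dom),
      ∀ φ ∈ spaceI (Sg K) (Rz K) M (k + 1) (domSites (F.P K) M (k + 1) Z) c.α₀ c.α₁, ∀ i : Fin (k + 1), (i : ℕ) < k →
      ∃ (Hc : ℂ → ℂ) (O : Set ℂ), DifferentiableOn ℂ Hc O ∧ (∀ t ∈ Ioc (0 : ℝ) θ.γ, closedBall (t : ℂ) (ϱt (k + 1) i) ⊆ O) ∧
        (∀ z ∈ O, ‖Hc z‖ ≤ A * Real.exp (-(R * (domSys (F.P K) M (k + 1)).dj Z))) ∧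
        (∀ t ∈ Ioc (0 : ℝ) θ.γ, Hc t = ((S K) k).H (Function.update g i t) φ Z))
    (hE : ∀ (K : ℕ), ∀ g ∈ Window θ.γ, ∀ k : ℕ, ∃ H : EHoloAt (sfTowerOfRecord (Sg K) (Rz K) M (S K) ⟨g, β K⟩ (logZ K)) c k, H.E₀ ≤ E₀ ∧ rE ≤ H.r)
    (hAn : ∀ K k, ((S K) k).AnalyticH (box θ.γ k) (fun X => spaceI (Sg K) (Rz K) M (k + 1) (domSites (F.P K) M (k + 1) X) c.α₀ c.α₁))
    (Ec : ℕ → ℕ → Type*) [∀ K k, NormedAddCommGroup (Ec K k)] [∀ K k, NormedSpace ℂ (Ec K k)]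
    (ι : letI := θ.instVβ₁; letI := θ.instVβ₂
      (K k : ℕ) → (domSys (F.P K) M (k + 1)).Dom → ((Fin (F.P K).d → Site (F.P K) (k + 1) → θ.Vβ) →L[ℝ] Ec K k))
    (Φ : (K k : ℕ) → (domSys (F.P K) M (k + 1)).Dom → Ec K k → CPair (F.P K) 𝔸)
    (U : (K k : ℕ) → (domSys (F.P K) M (k + 1)).Dom → Set (Ec K k)) (hU : ∀ K k X, IsOpen (U K k X)) (hrU : ∀ K k X, ball (0 : Ec K k) r ⊆ U K k X)
    (hΦhol : ∀ (K k : ℕ) (X : (domSys (F.P K) M (k + 1)).Dom), DifferentiableOn ℂ (Φ K k X) (U K k X))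
    (hΦemb : letI := θ.instVβ₁; letI := θ.instVβ₂
      ∀ (K k : ℕ) (X : (domSys (F.P K) M (k + 1)).Dom) (B : Fin (F.P K).d → Site (F.P K) (k + 1) → θ.Vβ),
        Φ K k X (ι K k X B) = emb K k (fun l t => NormedSpace.exp (θ.ρ8 (B l t))))
    (hΦsp : ∀ (K k : ℕ) (X : (domSys (F.P K) M (k + 1)).Dom), ∀ z ∈ U K k X, ∀ Z : (domSys (F.P K) M (k + 1)).Dom, Z.1 ⊆ X.1 →
      Φ K k X z ∈ spaceI (Sg K) (Rz K) M (k + 1) (domSites (F.P K) M (k + 1) Z) c.α₀ c.α₁)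
    (w : (K k : ℕ) → (domSys (F.P K) M (k + 1)).Dom → Site (F.P K) (k + 1) → ℝ) (hw₀ : ∀ K k X t, 0 ≤ w K k X t)
    (hw : letI := θ.instVβ₁; letI := θ.instVβ₂; letI := θ.instιβ
      ∀ (K k : ℕ) (X : (domSys (F.P K) M (k + 1)).Dom) (l : Fin (F.P K).d) (t : Site (F.P K) (k + 1)) (c : θ.ιβ),
        ‖ι K k X (Pi.single l (Pi.single t (θ.bV c)))‖ ≤ w K k X t)
    (htail : ∀ (K k : ℕ) (X : (domSys (F.P K) M (k + 1)).Dom) (t : Site (F.P K) (k + 1)),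
      let e : Site (F.P K) (k + 1) → TPt 4 (domCount (F.P K) M (k + 1) * M) := fun x i => (ZMod.cast (x i) : ZMod (domCount (F.P K) M (k + 1) * M))
      w K k X t ≤ B₃ * Real.exp (-δ₀ * distCT (domCount (F.P K) M (k + 1)) M (e t) (nearT (M := M) (e t) X)))
    (hℓκ : ℓ.κ ≤ delta1 δ₀ κ ((M : ℝ) * 4))
    (hdom : ∀ n i, 16 * B₃ ^ 2 / r ^ 2 * Real.exp (delta1 δ₀ κ ((M : ℝ) * 4) * ((M : ℝ) * 4) * 3) * K₀ (4 * 2 ^ 4) (2 * 4) * K₁ 4 (δ₀ / 2) *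
        (if i + 1 < n then 8 * (Real.exp 1 * 9 * 64 * K₀ 64 8 ^ 2) * (4 * A / ϱt n i) else 4 * E₀ / rE) ≤ ℓ.moduli n i) :
    NE9 ((objectsOfRecord₁₃ F N θ ℓ).EA 0) (Window θ.γ) ℓ.κ ℓ.moduli := by
  letI := θ.instVβ₁; letI := θ.instVβ₂; letI := θ.instιβ
  exact ne9_EA_objectsOfRecord₁₃_of_windowedLetter F N θ ℓ hs hlim S emb hloc
    (windowedNE9_localizedSum_of_olderCoordHolo_eHoloAt F m' M hM S emb θ.ρ8 θ.bV Sg Rz logZ β c (Window θ.γ) subset_rfl hγ ϱt hϱt hA hr₁ hκ hκ₀ hrate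
      hsmall hδ₀ hB₃ hr hE₀ hrE hκc h238 hO hE Ec ι Φ U hU hrU
      (fun g hg K k X => differentiableOn_H_comp_of_analyticH ((S K) k) (box θ.γ k)
        (fun X => spaceI (Sg K) (Rz K) M (k + 1) (domSites (F.P K) M (k + 1) X) c.α₀ c.α₁) (hAn K k) (histPrefix_mem_box hg k) (Φ K k X)
        (hΦhol K k X) X (hΦsp K k X))
      hΦemb hΦsp w hw₀ hw htail)
    hℓκ hdom

open Classical in
/-- ★★★ **THE N22 PIN FACE FROM J33 part 3 AT THE RECORD**, every run length `k`, at a Stage-13 rate reading whose node-U3 objects at the tuple ARE the kernel objects of record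
(`hpin`) — `ne9_EA_objectsOfRecord₁₃_of_olderCoordHolo_eHoloAt_analyticH` fed to dag-n22-w3's `n22At_rateCarriers_of_kernels_pin_of_ne9` (= K3⁷ v5 §2b `n22At_rrOfRecord_of_pinned` at
the selector's value).  LOCATED (hypothesis form); N22 NOT discharged. -/
theorem n22At_rateCarriers_of_kernels_pin_of_olderCoordHolo_eHoloAt_analyticH (𝔯 : RateReading₁₃CoPH N) (θ : Stage13HParams F N)
    (hP : θ.Provisos₁₃CoPH F N) (g₀ : ℕ → ℝ) (os : List (ULoop F)) (ℓ : U3Letters₁₁) (hs : ℓ.Signs)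
    (hpin : (𝔯.lit F θ hP g₀ os).u3 = objectsOfRecord₁₃ F N θ.toStage13Params ℓ) (hlim : PolLimitsExistOfRecord₁₃ F N θ.toStage13Params)
    {𝔸 : Type*} [NormedRing 𝔸] [NormedAlgebra ℂ 𝔸] [CompleteSpace 𝔸] {G : Type*} [GaugeGroup G]
    (m' : ℕ) (M : ℕ) [NeZero M] (hM : M = F.L ^ m')
    (S : (K : ℕ) → ClusterTower (F.P K) 𝔸 M) (emb : ReadingMaps F (MatA N) 𝔸) (hloc : Localizes17OfRecord₁₃ F N θ.toStage13Params S emb)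
    (Sg : (K : ℕ) → Setting 𝔸 G) (Rz : (K : ℕ) → Residual (F.P K) 𝔸) (logZ : (K : ℕ) → ℕ → GaugeField (F.P K) 0 G → ℝ) (β : ℕ → ℕ → ℝ → ℝ)
    (c : SFConsts) (hγ : θ.γ ≤ c.γ)
    {A R r₁ κ δ₀ B₃ r E₀ rE : ℝ} (ϱt : ℕ → ℕ → ℝ) (hϱt : ∀ n i, 0 < ϱt n i)
    (hA : 0 < A) (hr₁ : 0 ≤ r₁) (hκ : κ ≤ r₁) (hκ₀ : kappa₀ (4 * 2 ^ 4) (2 * 4) ≤ κ / 2) (hrate : r₁ + 2 * (64 * Real.log 162) + 2 ≤ R)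
    (hsmall : 2 * A * Real.exp (5 * r₁ + 1) * K₀ 64 8 * 9 * 64 ≤ 1) (hδ₀ : 0 < δ₀) (hB₃ : 0 ≤ B₃) (hr : 0 < r)
    (hE₀ : 0 ≤ E₀) (hrE : 0 < rE) (hκc : κ ≤ c.κ)
    (h238 : ∀ K k, ((S K) k).Bound238 (box θ.γ k) (fun X => spaceI (Sg K) (Rz K) M (k + 1) (domSites (F.P K) M (k + 1) X) c.α₀ c.α₁) A R)
    (hO : ∀ (K k : ℕ), ∀ g ∈ box θ.γ k, ∀ (Z : (domSys (F.P K) M (k + 1)).Dom),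
      ∀ φ ∈ spaceI (Sg K) (Rz K) M (k + 1) (domSites (F.P K) M (k + 1) Z) c.α₀ c.α₁, ∀ i : Fin (k + 1), (i : ℕ) < k →
      ∃ (Hc : ℂ → ℂ) (O : Set ℂ), DifferentiableOn ℂ Hc O ∧ (∀ t ∈ Ioc (0 : ℝ) θ.γ, closedBall (t : ℂ) (ϱt (k + 1) i) ⊆ O) ∧
        (∀ z ∈ O, ‖Hc z‖ ≤ A * Real.exp (-(R * (domSys (F.P K) M (k + 1)).dj Z))) ∧
        (∀ t ∈ Ioc (0 : ℝ) θ.γ, Hc t = ((S K) k).H (Function.update g i t) φ Z))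
    (hE : ∀ (K : ℕ), ∀ g ∈ Window θ.γ, ∀ k : ℕ, ∃ H : EHoloAt (sfTowerOfRecord (Sg K) (Rz K) M (S K) ⟨g, β K⟩ (logZ K)) c k, H.E₀ ≤ E₀ ∧ rE ≤ H.r)
    (hAn : ∀ K k, ((S K) k).AnalyticH (box θ.γ k) (fun X => spaceI (Sg K) (Rz K) M (k + 1) (domSites (F.P K) M (k + 1) X) c.α₀ c.α₁))
    (Ec : ℕ → ℕ → Type*) [∀ K k, NormedAddCommGroup (Ec K k)] [∀ K k, NormedSpace ℂ (Ec K k)]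
    (ι : letI := θ.instVβ₁; letI := θ.instVβ₂
      (K k : ℕ) → (domSys (F.P K) M (k + 1)).Dom → ((Fin (F.P K).d → Site (F.P K) (k + 1) → θ.Vβ) →L[ℝ] Ec K k))
    (Φ : (K k : ℕ) → (domSys (F.P K) M (k + 1)).Dom → Ec K k → CPair (F.P K) 𝔸)
    (U : (K k : ℕ) → (domSys (F.P K) M (k + 1)).Dom → Set (Ec K k)) (hU : ∀ K k X, IsOpen (U K k X)) (hrU : ∀ K k X, ball (0 : Ec K k) r ⊆ U K k X)
    (hΦhol : ∀ (K k : ℕ) (X : (domSys (F.P K) M (k + 1)).Dom), DifferentiableOn ℂ (Φ K k X) (U K k X))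
    (hΦemb : letI := θ.instVβ₁; letI := θ.instVβ₂
      ∀ (K k : ℕ) (X : (domSys (F.P K) M (k + 1)).Dom) (B : Fin (F.P K).d → Site (F.P K) (k + 1) → θ.Vβ),
        Φ K k X (ι K k X B) = emb K k (fun l t => NormedSpace.exp (θ.ρ8 (B l t))))
    (hΦsp : ∀ (K k : ℕ) (X : (domSys (F.P K) M (k + 1)).Dom), ∀ z ∈ U K k X, ∀ Z : (domSys (F.P K) M (k + 1)).Dom, Z.1 ⊆ X.1 →
      Φ K k X z ∈ spaceI (Sg K) (Rz K) M (k + 1) (domSites (F.P K) M (k + 1) Z) c.α₀ c.α₁)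
    (w : (K k : ℕ) → (domSys (F.P K) M (k + 1)).Dom → Site (F.P K) (k + 1) → ℝ) (hw₀ : ∀ K k X t, 0 ≤ w K k X t)
    (hw : letI := θ.instVβ₁; letI := θ.instVβ₂; letI := θ.instιβ
      ∀ (K k : ℕ) (X : (domSys (F.P K) M (k + 1)).Dom) (l : Fin (F.P K).d) (t : Site (F.P K) (k + 1)) (c : θ.ιβ),
        ‖ι K k X (Pi.single l (Pi.single t (θ.bV c)))‖ ≤ w K k X t)
    (htail : ∀ (K k : ℕ) (X : (domSys (F.P K) M (k + 1)).Dom) (t : Site (F.P K) (k + 1)),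
      let e : Site (F.P K) (k + 1) → TPt 4 (domCount (F.P K) M (k + 1) * M) := fun x i => (ZMod.cast (x i) : ZMod (domCount (F.P K) M (k + 1) * M))
      w K k X t ≤ B₃ * Real.exp (-δ₀ * distCT (domCount (F.P K) M (k + 1)) M (e t) (nearT (M := M) (e t) X)))
    (hℓκ : ℓ.κ ≤ delta1 δ₀ κ ((M : ℝ) * 4))
    (hdom : ∀ n i, 16 * B₃ ^ 2 / r ^ 2 * Real.exp (delta1 δ₀ κ ((M : ℝ) * 4) * ((M : ℝ) * 4) * 3) * K₀ (4 * 2 ^ 4) (2 * 4) * K₁ 4 (δ₀ / 2) *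
        (if i + 1 < n then 8 * (Real.exp 1 * 9 * 64 * K₀ 64 8 ^ 2) * (4 * A / ϱt n i) else 4 * E₀ / rE) ≤ ℓ.moduli n i) (k : ℕ) :
    N22At (rateCarriersOfRecord₁₃CoPH 𝔯 F θ hP g₀ os k).u3 :=
  n22At_rateCarriers_of_kernels_pin_of_ne9 𝔯 θ hP g₀ os ℓ hs hpin
    (ne9_EA_objectsOfRecord₁₃_of_olderCoordHolo_eHoloAt_analyticH F N θ.toStage13Params ℓ hs hlim m' M hM S emb hloc Sg Rz logZ β c hγ ϱt hϱt hA hr₁ hκ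
      hκ₀ hrate hsmall hδ₀ hB₃ hr hE₀ hrE hκc h238 hO hE hAn Ec ι Φ U hU hrU hΦhol hΦemb hΦsp w hw₀ hw htail hℓκ hdom) k

/-! ## §2 J35 READ AT THE RECORD: node N10's older-coupling schema + node N09's `EHoloAt` families + Lemma 3's socket numerals (the end-to-end analytic road) -/

open Classical in
/-- ★★★ **K3⁷ v5 §2b's `h9` FROM THE PER-STEP SCHEMAS** (J35 at the record).  Towers `S K : ClusterTower (F.P K) 𝔸 M` (`M = L_F^{m′}`) read through `emb : ReadingMaps F (MatA N) 𝔸`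
with W1-20's law `Localizes17OfRecord₁₃ F N θ S emb`, at the space tables of record `U^c_{k+1}(X, cs.α₀, cs.α₁)`; per torus `K`: node N10's older-coupling level-T hypothesis
`h226TOnOlder` UNIVERSAL IN THE DOMAIN, node N09's `EHoloAt (sfTowerOfRecord (Sg K) (Rz K) M (S K) ⟨g, β K⟩ (logZ K)) cs k` per window history and step with uniform letters
`(E₀, r_E > 0)`, the socket numerals `Lemma3Numerics c M (½L) …`, `8 ≤ c.L`, S25's clauses at `A := C₃ε₁`, the renewal `e·9·64·K₀(64,8)²C₃ε₁ ≤ E₀`, `θ.γ ≤ cs.γ`, `κ ≤ cs.κ`;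
J34's term holomorphy `hEhol` through the complexified readings `Φ K k X` (open `U ⊇ ball 0 r`, chart clause, the ball mapped into `U^c_{k+1}(X)`); site weights with tails,
`δ₀ > 0`, `2κ₀(64,8) ≤ κ_w ≤ κ`; `PolLimitsExistOfRecord₁₃ F N θ`; a letter block with `ℓ.κ ≤ δ₁(δ₀, κ_w)` and `C·4E₀∕r_E ≤ ℓ.moduli` ⟹
`NE9 ((objectsOfRecord₁₃ F N θ ℓ).EA 0) (Window θ.γ) ℓ.κ ℓ.moduli` — J35 `windowedNE9_localizedSum_of_stripSchemas` at `W := Window θ.γ` ∘ p613896 §1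
`ne9_EA_objectsOfRecord₁₃_of_windowedLetter`.  NO activity-level slot is displayed.  LOCATED (hypothesis form); N22 NOT discharged. -/
theorem ne9_EA_objectsOfRecord₁₃_of_stripSchemas (θ : Stage13Params F N) (ℓ : U3Letters₁₁) (hs : ℓ.Signs) (hlim : PolLimitsExistOfRecord₁₃ F N θ)
    {𝔸 : Type*} [NormedRing 𝔸] [NormedAlgebra ℂ 𝔸] [CompleteSpace 𝔸] {G : Type*} [GaugeGroup G]
    (m' : ℕ) (M : ℕ) [NeZero M] (hM : M = F.L ^ m')
    (S : (K : ℕ) → ClusterTower (F.P K) 𝔸 M) (emb : ReadingMaps F (MatA N) 𝔸) (hloc : Localizes17OfRecord₁₃ F N θ S emb)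
    (Sg : (K : ℕ) → Setting 𝔸 G) (Rz : (K : ℕ) → Residual (F.P K) 𝔸) (logZ : (K : ℕ) → ℕ → GaugeField (F.P K) 0 G → ℝ) (β : ℕ → ℕ → ℝ → ℝ)
    (c : B13.Consts) {L : ℕ} [NeZero L] (hL : 8 ≤ c.L) (hLc : c.L = L) {a a₂ a₂' a₅ Aabs : ℝ} (hN : Lemma3Numerics c M ((c.L : ℝ) / 2) a a₂ a₂' a₅ Aabs)
    (cs : SFConsts) (hγ : θ.γ ≤ cs.γ)
    {rE E₀ κ r₁ κw δ₀ B₃ r : ℝ} (hrE : 0 < rE) (hA0 : 0 ≤ c.C3act * c.ε₁) (hr₁ : 0 ≤ r₁) (hκ : κ ≤ r₁)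
    (hrate : r₁ + 2 * (64 * Real.log 162) + 2 ≤ (1 - 8 * c.δ) * ((c.L : ℝ) / 2) * c.κ)
    (hsmall : c.C3act * c.ε₁ * Real.exp (5 * r₁ + 1) * K₀ 64 8 * 9 * 64 ≤ 1)
    (hrenew : Real.exp 1 * 9 * 64 * K₀ 64 8 ^ 2 * (c.C3act * c.ε₁) ≤ E₀) (hκc : κ ≤ cs.κ)
    (hκ₀ : kappa₀ (4 * 2 ^ 4) (2 * 4) ≤ κw / 2) (hκw : κw ≤ κ) (hδ₀ : 0 < δ₀) (hB₃ : 0 ≤ B₃) (hr : 0 < r)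
    (h226TOnOlder : ∀ K : ℕ,
      ∀ (D : Set ℂ), IsOpen D → (∀ t ∈ Ioc (0 : ℝ) θ.γ, closedBall (t : ℂ) rE ⊆ D) →
        ∀ (k : ℕ) (g : ℕ → ℝ), g ∈ Window θ.γ → ∀ (i : ℕ), i < k → ∀ (X : (domSys (F.P K) M (k + 1)).Dom) (φ : CPair (F.P K) 𝔸),
        φ ∈ spaceI (Sg K) (Rz K) M (k + 1) (domSites (F.P K) M (k + 1) X) cs.α₀ cs.α₁ →
        (∀ (j : ℕ), j < k + 1 → ∀ (Y : (domSys (F.P K) M j).Dom) (ψ : CPair (F.P K) 𝔸), ψ ∈ spaceI (Sg K) (Rz K) M j (domSites (F.P K) M j Y) cs.α₀ cs.α₁ →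
          ∃ Ec : ℂ → ℂ, DifferentiableOn ℂ Ec D ∧ (∀ z ∈ D, ‖Ec z‖ ≤ E₀ * Real.exp (-(κ * torusTreeLen Y.1))) ∧
            (∀ t ∈ Ioc (0 : ℝ) θ.γ, Ec t = termC (S K) j Y (Function.update g i t) ψ)) →
        ∃ (Hc : ℂ → TDom 4 (domCount (F.P K) M (k + 1)) → ℂ)
          (Tt : (Z : TDom 4 (domCount (F.P K) M (k + 1))) →
            Finset (TDom 4 (L * domCount (F.P K) M (k + 1))) × Finset (TBond 4 M (L * domCount (F.P K) M (k + 1))) → ℂ → ℂ),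
          (∀ Z : (domSys (F.P K) M (k + 1)).Dom, Z.1 ⊆ X.1 → DifferentiableOn ℂ (fun z => Hc z Z) D) ∧
          (∀ z ∈ D, ∀ Z : TDom 4 (domCount (F.P K) M (k + 1)), Z.1 ⊆ X.1 → ‖Hc z Z‖ ≤ ∑ t ∈ terms L M Z, ‖Tt Z t z‖) ∧
          (∀ z ∈ D, ∀ Z : TDom 4 (domCount (F.P K) M (k + 1)), Z.1 ⊆ X.1 → ∀ t ∈ terms L M Z,
            ‖Tt Z t z‖ ≤ weight L M c Z a t * Real.exp (a₅ * ((Z.1).card : ℝ))) ∧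
          (∀ t ∈ Ioc (0 : ℝ) θ.γ, Hc t = ((S K) k).H (restrictPrefix k (Function.update g i t)) φ))
    (hE : ∀ (K : ℕ), ∀ g ∈ Window θ.γ, ∀ k : ℕ, ∃ H : EHoloAt (sfTowerOfRecord (Sg K) (Rz K) M (S K) ⟨g, β K⟩ (logZ K)) cs k, H.E₀ ≤ E₀ ∧ rE ≤ H.r)
    (Ec : ℕ → ℕ → Type*) [∀ K k, NormedAddCommGroup (Ec K k)] [∀ K k, NormedSpace ℂ (Ec K k)]
    (ι : letI := θ.instVβ₁; letI := θ.instVβ₂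
      (K k : ℕ) → (domSys (F.P K) M (k + 1)).Dom → ((Fin (F.P K).d → Site (F.P K) (k + 1) → θ.Vβ) →L[ℝ] Ec K k))
    (Φ : (K k : ℕ) → (domSys (F.P K) M (k + 1)).Dom → Ec K k → CPair (F.P K) 𝔸)
    (U : (K k : ℕ) → (domSys (F.P K) M (k + 1)).Dom → Set (Ec K k)) (hU : ∀ K k X, IsOpen (U K k X)) (hrU : ∀ K k X, ball (0 : Ec K k) r ⊆ U K k X)
    (hEhol : ∀ g ∈ Window θ.γ, ∀ (K k : ℕ) (X : (domSys (F.P K) M (k + 1)).Dom),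
      DifferentiableOn ℂ (fun z => ((S K) k).E (histPrefix g k) (Φ K k X z) X) (U K k X))
    (hΦemb : letI := θ.instVβ₁; letI := θ.instVβ₂
      ∀ (K k : ℕ) (X : (domSys (F.P K) M (k + 1)).Dom) (B : Fin (F.P K).d → Site (F.P K) (k + 1) → θ.Vβ),
        Φ K k X (ι K k X B) = emb K k (fun l t => NormedSpace.exp (θ.ρ8 (B l t))))
    (hΦsp : ∀ (K k : ℕ) (X : (domSys (F.P K) M (k + 1)).Dom), ∀ z ∈ ball (0 : Ec K k) r,
      Φ K k X z ∈ spaceI (Sg K) (Rz K) M (k + 1) (domSites (F.P K) M (k + 1) X) cs.α₀ cs.α₁)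
    (w : (K k : ℕ) → (domSys (F.P K) M (k + 1)).Dom → Site (F.P K) (k + 1) → ℝ) (hw₀ : ∀ K k X t, 0 ≤ w K k X t)
    (hw : letI := θ.instVβ₁; letI := θ.instVβ₂; letI := θ.instιβ
      ∀ (K k : ℕ) (X : (domSys (F.P K) M (k + 1)).Dom) (l : Fin (F.P K).d) (t : Site (F.P K) (k + 1)) (c : θ.ιβ),
        ‖ι K k X (Pi.single l (Pi.single t (θ.bV c)))‖ ≤ w K k X t)
    (htail : ∀ (K k : ℕ) (X : (domSys (F.P K) M (k + 1)).Dom) (t : Site (F.P K) (k + 1)),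
      let e : Site (F.P K) (k + 1) → TPt 4 (domCount (F.P K) M (k + 1) * M) := fun x i => (ZMod.cast (x i) : ZMod (domCount (F.P K) M (k + 1) * M))
      w K k X t ≤ B₃ * Real.exp (-δ₀ * distCT (domCount (F.P K) M (k + 1)) M (e t) (nearT (M := M) (e t) X)))
    (hℓκ : ℓ.κ ≤ delta1 δ₀ κw ((M : ℝ) * 4))
    (hdom : ∀ n i, 16 * B₃ ^ 2 / r ^ 2 * Real.exp (delta1 δ₀ κw ((M : ℝ) * 4) * ((M : ℝ) * 4) * 3) * K₀ (4 * 2 ^ 4) (2 * 4) * K₁ 4 (δ₀ / 2) *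
        (4 * E₀ / rE) ≤ ℓ.moduli n i) :
    NE9 ((objectsOfRecord₁₃ F N θ ℓ).EA 0) (Window θ.γ) ℓ.κ ℓ.moduli := by
  letI := θ.instVβ₁; letI := θ.instVβ₂; letI := θ.instιβ
  exact ne9_EA_objectsOfRecord₁₃_of_windowedLetter F N θ ℓ hs hlim S emb hloc
    (windowedNE9_localizedSum_of_stripSchemas F m' M hM S emb θ.ρ8 θ.bV Sg Rz logZ β c hL hLc hN cs (Window θ.γ) subset_rfl hγ hrE hA0 hr₁ hκ hrate
      hsmall hrenew hκc hκ₀ hκw hδ₀ hB₃ hr h226TOnOlder hE Ec ι Φ U hU hrU hEhol hΦemb hΦsp w hw₀ hw htail)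
    hℓκ hdom

open Classical in
/-- ★★★ **THE N22 PIN FACE FROM THE PER-STEP SCHEMAS** (J35 at the record) — `N22At (rateCarriersOfRecord₁₃CoPH 𝔯 F θ hP g₀ os k).u3` for EVERY `k` under `hpin` (K3⁷ v5's
`U3PinnedKernels` at the tuple): `ne9_EA_objectsOfRecord₁₃_of_stripSchemas` fed to dag-n22-w3's `n22At_rateCarriers_of_kernels_pin_of_ne9`.  THE N22 ROW SENTENCE in schema currency —
«W1-20's law + N10's older-coupling schema + N09's `EHoloAt` families + term holomorphy through the readings + p. 282 tails + (1.21) existence + numerals + a dominating letter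
block ⇒ `N22At` at the pinned bundle, every run length».  LOCATED (hypothesis form); N22 NOT discharged. -/
theorem n22At_rateCarriers_of_kernels_pin_of_stripSchemas (𝔯 : RateReading₁₃CoPH N) (θ : Stage13HParams F N) (hP : θ.Provisos₁₃CoPH F N)
    (g₀ : ℕ → ℝ) (os : List (ULoop F)) (ℓ : U3Letters₁₁) (hs : ℓ.Signs) (hpin : (𝔯.lit F θ hP g₀ os).u3 = objectsOfRecord₁₃ F N θ.toStage13Params ℓ)
    (hlim : PolLimitsExistOfRecord₁₃ F N θ.toStage13Params)
    {𝔸 : Type*} [NormedRing 𝔸] [NormedAlgebra ℂ 𝔸] [CompleteSpace 𝔸] {G : Type*} [GaugeGroup G]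
    (m' : ℕ) (M : ℕ) [NeZero M] (hM : M = F.L ^ m')
    (S : (K : ℕ) → ClusterTower (F.P K) 𝔸 M) (emb : ReadingMaps F (MatA N) 𝔸) (hloc : Localizes17OfRecord₁₃ F N θ.toStage13Params S emb)
    (Sg : (K : ℕ) → Setting 𝔸 G) (Rz : (K : ℕ) → Residual (F.P K) 𝔸) (logZ : (K : ℕ) → ℕ → GaugeField (F.P K) 0 G → ℝ) (β : ℕ → ℕ → ℝ → ℝ)
    (c : B13.Consts) {L : ℕ} [NeZero L] (hL : 8 ≤ c.L) (hLc : c.L = L) {a a₂ a₂' a₅ Aabs : ℝ} (hN : Lemma3Numerics c M ((c.L : ℝ) / 2) a a₂ a₂' a₅ Aabs)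
    (cs : SFConsts) (hγ : θ.γ ≤ cs.γ)
    {rE E₀ κ r₁ κw δ₀ B₃ r : ℝ} (hrE : 0 < rE) (hA0 : 0 ≤ c.C3act * c.ε₁) (hr₁ : 0 ≤ r₁) (hκ : κ ≤ r₁)
    (hrate : r₁ + 2 * (64 * Real.log 162) + 2 ≤ (1 - 8 * c.δ) * ((c.L : ℝ) / 2) * c.κ)
    (hsmall : c.C3act * c.ε₁ * Real.exp (5 * r₁ + 1) * K₀ 64 8 * 9 * 64 ≤ 1)
    (hrenew : Real.exp 1 * 9 * 64 * K₀ 64 8 ^ 2 * (c.C3act * c.ε₁) ≤ E₀) (hκc : κ ≤ cs.κ)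
    (hκ₀ : kappa₀ (4 * 2 ^ 4) (2 * 4) ≤ κw / 2) (hκw : κw ≤ κ) (hδ₀ : 0 < δ₀) (hB₃ : 0 ≤ B₃) (hr : 0 < r)
    (h226TOnOlder : ∀ K : ℕ,
      ∀ (D : Set ℂ), IsOpen D → (∀ t ∈ Ioc (0 : ℝ) θ.γ, closedBall (t : ℂ) rE ⊆ D) →
        ∀ (k : ℕ) (g : ℕ → ℝ), g ∈ Window θ.γ → ∀ (i : ℕ), i < k → ∀ (X : (domSys (F.P K) M (k + 1)).Dom) (φ : CPair (F.P K) 𝔸),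
        φ ∈ spaceI (Sg K) (Rz K) M (k + 1) (domSites (F.P K) M (k + 1) X) cs.α₀ cs.α₁ →
        (∀ (j : ℕ), j < k + 1 → ∀ (Y : (domSys (F.P K) M j).Dom) (ψ : CPair (F.P K) 𝔸), ψ ∈ spaceI (Sg K) (Rz K) M j (domSites (F.P K) M j Y) cs.α₀ cs.α₁ →
          ∃ Ec : ℂ → ℂ, DifferentiableOn ℂ Ec D ∧ (∀ z ∈ D, ‖Ec z‖ ≤ E₀ * Real.exp (-(κ * torusTreeLen Y.1))) ∧
            (∀ t ∈ Ioc (0 : ℝ) θ.γ, Ec t = termC (S K) j Y (Function.update g i t) ψ)) →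
        ∃ (Hc : ℂ → TDom 4 (domCount (F.P K) M (k + 1)) → ℂ)
          (Tt : (Z : TDom 4 (domCount (F.P K) M (k + 1))) →
            Finset (TDom 4 (L * domCount (F.P K) M (k + 1))) × Finset (TBond 4 M (L * domCount (F.P K) M (k + 1))) → ℂ → ℂ),
          (∀ Z : (domSys (F.P K) M (k + 1)).Dom, Z.1 ⊆ X.1 → DifferentiableOn ℂ (fun z => Hc z Z) D) ∧
          (∀ z ∈ D, ∀ Z : TDom 4 (domCount (F.P K) M (k + 1)), Z.1 ⊆ X.1 → ‖Hc z Z‖ ≤ ∑ t ∈ terms L M Z, ‖Tt Z t z‖) ∧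
          (∀ z ∈ D, ∀ Z : TDom 4 (domCount (F.P K) M (k + 1)), Z.1 ⊆ X.1 → ∀ t ∈ terms L M Z,
            ‖Tt Z t z‖ ≤ weight L M c Z a t * Real.exp (a₅ * ((Z.1).card : ℝ))) ∧
          (∀ t ∈ Ioc (0 : ℝ) θ.γ, Hc t = ((S K) k).H (restrictPrefix k (Function.update g i t)) φ))
    (hE : ∀ (K : ℕ), ∀ g ∈ Window θ.γ, ∀ k : ℕ, ∃ H : EHoloAt (sfTowerOfRecord (Sg K) (Rz K) M (S K) ⟨g, β K⟩ (logZ K)) cs k, H.E₀ ≤ E₀ ∧ rE ≤ H.r)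
    (Ec : ℕ → ℕ → Type*) [∀ K k, NormedAddCommGroup (Ec K k)] [∀ K k, NormedSpace ℂ (Ec K k)]
    (ι : letI := θ.instVβ₁; letI := θ.instVβ₂
      (K k : ℕ) → (domSys (F.P K) M (k + 1)).Dom → ((Fin (F.P K).d → Site (F.P K) (k + 1) → θ.Vβ) →L[ℝ] Ec K k))
    (Φ : (K k : ℕ) → (domSys (F.P K) M (k + 1)).Dom → Ec K k → CPair (F.P K) 𝔸)
    (U : (K k : ℕ) → (domSys (F.P K) M (k + 1)).Dom → Set (Ec K k)) (hU : ∀ K k X, IsOpen (U K k X)) (hrU : ∀ K k X, ball (0 : Ec K k) r ⊆ U K k X)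
    (hEhol : ∀ g ∈ Window θ.γ, ∀ (K k : ℕ) (X : (domSys (F.P K) M (k + 1)).Dom),
      DifferentiableOn ℂ (fun z => ((S K) k).E (histPrefix g k) (Φ K k X z) X) (U K k X))
    (hΦemb : letI := θ.instVβ₁; letI := θ.instVβ₂
      ∀ (K k : ℕ) (X : (domSys (F.P K) M (k + 1)).Dom) (B : Fin (F.P K).d → Site (F.P K) (k + 1) → θ.Vβ),
        Φ K k X (ι K k X B) = emb K k (fun l t => NormedSpace.exp (θ.ρ8 (B l t))))
    (hΦsp : ∀ (K k : ℕ) (X : (domSys (F.P K) M (k + 1)).Dom), ∀ z ∈ ball (0 : Ec K k) r,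
      Φ K k X z ∈ spaceI (Sg K) (Rz K) M (k + 1) (domSites (F.P K) M (k + 1) X) cs.α₀ cs.α₁)
    (w : (K k : ℕ) → (domSys (F.P K) M (k + 1)).Dom → Site (F.P K) (k + 1) → ℝ) (hw₀ : ∀ K k X t, 0 ≤ w K k X t)
    (hw : letI := θ.instVβ₁; letI := θ.instVβ₂; letI := θ.instιβ
      ∀ (K k : ℕ) (X : (domSys (F.P K) M (k + 1)).Dom) (l : Fin (F.P K).d) (t : Site (F.P K) (k + 1)) (c : θ.ιβ),
        ‖ι K k X (Pi.single l (Pi.single t (θ.bV c)))‖ ≤ w K k X t)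
    (htail : ∀ (K k : ℕ) (X : (domSys (F.P K) M (k + 1)).Dom) (t : Site (F.P K) (k + 1)),
      let e : Site (F.P K) (k + 1) → TPt 4 (domCount (F.P K) M (k + 1) * M) := fun x i => (ZMod.cast (x i) : ZMod (domCount (F.P K) M (k + 1) * M))
      w K k X t ≤ B₃ * Real.exp (-δ₀ * distCT (domCount (F.P K) M (k + 1)) M (e t) (nearT (M := M) (e t) X)))
    (hℓκ : ℓ.κ ≤ delta1 δ₀ κw ((M : ℝ) * 4))
    (hdom : ∀ n i, 16 * B₃ ^ 2 / r ^ 2 * Real.exp (delta1 δ₀ κw ((M : ℝ) * 4) * ((M : ℝ) * 4) * 3) * K₀ (4 * 2 ^ 4) (2 * 4) * K₁ 4 (δ₀ / 2) *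
        (4 * E₀ / rE) ≤ ℓ.moduli n i) (k : ℕ) :
    N22At (rateCarriersOfRecord₁₃CoPH 𝔯 F θ hP g₀ os k).u3 :=
  n22At_rateCarriers_of_kernels_pin_of_ne9 𝔯 θ hP g₀ os ℓ hs hpin
    (ne9_EA_objectsOfRecord₁₃_of_stripSchemas F N θ.toStage13Params ℓ hs hlim m' M hM S emb hloc Sg Rz logZ β c hL hLc hN cs hγ hrE hA0 hr₁ hκ hrate hsmall
      hrenew hκc hκ₀ hκw hδ₀ hB₃ hr h226TOnOlder hE Ec ι Φ U hU hrU hEhol hΦemb hΦsp w hw₀ hw htail hℓκ hdom) k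

end YMDAG.N22.AtRecordOfPrintedSlots

end
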